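import Literature.Computability.AlgebraicComplexity.TableauEvalBridge
import Literature.Computability.AlgebraicComplexity.TableauScaling
import Mathlib.Logic.Equiv.Fin.Basic
import Mathlib.Data.Fintype.Sigma
import HarnessLib

/-!
# Closed form of the kernel evaluator and the tableau datum of a network

Lean checker of the GCT multiplicity-obstruction engine (cell `pub-gct`; honest framing: rung-1
multiplicity-obstruction search for permanent versus determinant at small `(n, m)`, no claim about
VP ≠ VNP or P ≠ NP), step H1d (second half). Continuing `TableauEvalBridge.lean`:

* §4 lengths and letters of the words the program accumulates (`length_finalAcc_getD`,
  `mem_finalAcc_getD`);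
* §5 **`evalC_eq_sum_S`**: `evalC P N = ∑_π sgn(π) ∏_{u<d} S(∑_i colContent_i(π_i, u))`;
* §6 the tableau datum `TabM.ofNetwork E N F` of a list network (columns, alternator variables
  `E.x v`, boxes enumerated by a frame `F : NetFrame N`), the identity of contents
  `wordContent (word π u) = ∑_i colContent_i(π_i, u)`, and **`TabM.EC_ofNetwork`**: the kernel's
  `evalC P N` IS the mathematical `EC` of that datum at the presentation `(coefM P, formM E P m)`;
  a frame exists as soon as the structural check holds (`NetFrame.ofCounts`, from the content
  condition `m` boxes per label).

Elementary [folklore].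
-/

noncomputable section

open scoped BigOperators

namespace Literature.Computability.AlgebraicComplexity

namespace TableauEval

open MvPolynomial

variable {σ : Type*} [Fintype σ] [DecidableEq σ] {K : Type*} [CommRing K]
variable {Nv : ℕ} (E : Enum σ Nv)

/-! ## §4 Lengths and letters of the final words -/

omit [Fintype σ] [DecidableEq σ] in
/-- `consAt` lengthens exactly one word by one (label in range). [folklore] -/
theorem length_consAt_getD : ∀ (acc : List (List ℕ)) (u i u' : ℕ), u < acc.length →
    ((consAt acc u i).getD u' []).length = (acc.getD u' []).length + if u' = u then 1 else 0
  | [], u, i, u', h => absurd h (Nat.not_lt_zero _)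
  | l :: ls, 0, i, 0, _ => by simp [consAt]
  | l :: ls, 0, i, u' + 1, _ => by simp [consAt]
  | l :: ls, u + 1, i, 0, _ => by simp [consAt]
  | l :: ls, u + 1, i, u' + 1, h => by
    rw [consAt, List.getD_cons_succ, List.getD_cons_succ,
      length_consAt_getD ls u i u' (by simpa using h)]
    simp

omit [Fintype σ] [DecidableEq σ] in
/-- `pushAll` lengthens the word of label `u` by the number of rows labelled `u` (labels in
range). [folklore] -/
theorem length_pushAll_getD : ∀ (acc : List (List ℕ)) (us is : List ℕ), us.length = is.length →
    (∀ u' ∈ us, u' < acc.length) →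
    ∀ u : ℕ, ((pushAll acc us is).getD u []).length = (acc.getD u []).length + countNat u us
  | acc, [], [], _, _, u => by simp [pushAll, countNat]
  | acc, [], _ :: _, h, _, _ => absurd h (by simp)
  | acc, _ :: _, [], h, _, _ => absurd h (by simp)
  | acc, u' :: us, i :: is, h, hus, u => by
    have hu' : u' < acc.length := hus u' List.mem_cons_self
    rw [pushAll, length_pushAll_getD (consAt acc u' i) us is (by simpa using h)
      (fun v hv => by rw [length_consAt]; exact hus v (List.mem_cons_of_mem _ hv)) u,
      length_consAt_getD acc u' i u hu', countNat, countNat, List.filter_cons]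
    by_cases hu : u' = u
    · subst hu; simp; omega
    · simp [hu, Ne.symm hu]

omit [Fintype σ] [DecidableEq σ] in
/-- Letters of the words after `consAt` are old letters or the new one. [folklore] -/
theorem mem_consAt_getD : ∀ (acc : List (List ℕ)) (u i u' j : ℕ),
    j ∈ (consAt acc u i).getD u' [] → j ∈ acc.getD u' [] ∨ j = i
  | [], u, i, u', j, h => by simp [consAt] at h
  | l :: ls, 0, i, 0, j, h => by
    simp only [consAt, List.getD_cons_zero, List.mem_cons] at h
    rcases h with h | h
    · exact Or.inr h
    · exact Or.inl (by simpa using h)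
  | l :: ls, 0, i, u' + 1, j, h => Or.inl (by simpa [consAt] using h)
  | l :: ls, u + 1, i, 0, j, h => Or.inl (by simpa [consAt] using h)
  | l :: ls, u + 1, i, u' + 1, j, h => by
    rw [consAt, List.getD_cons_succ] at h
    rw [List.getD_cons_succ]
    exact mem_consAt_getD ls u i u' j h

omit [Fintype σ] [DecidableEq σ] in
/-- Letters of the words after `pushAll` are old letters or fed variables. [folklore] -/
theorem mem_pushAll_getD : ∀ (acc : List (List ℕ)) (us is : List ℕ) (u j : ℕ),
    j ∈ (pushAll acc us is).getD u [] → j ∈ acc.getD u [] ∨ j ∈ is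
  | acc, [], is, u, j, h => by cases is <;> exact Or.inl (by simpa [pushAll] using h)
  | acc, _ :: _, [], u, j, h => Or.inl (by simpa [pushAll] using h)
  | acc, u' :: us, i :: is, u, j, h => by
    rw [pushAll] at h
    rcases mem_pushAll_getD (consAt acc u' i) us is u j h with h1 | h1
    · rcases mem_consAt_getD acc u' i u j h1 with h2 | h2
      · exact Or.inl h2
      · exact Or.inr (h2 ▸ List.mem_cons_self)
    · exact Or.inr (List.mem_cons_of_mem _ h1)

omit [Fintype σ] [DecidableEq σ] in
/-- Lengths of the final words: initial length plus the number of boxes of that label (labels in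
range). [folklore] -/
theorem length_finalAcc_getD : ∀ (cs : List Column) (_ : ∀ c ∈ cs, c.vars.length = c.labels.length)
    (π : BijL cs) (acc : List (List ℕ)) (_ : ∀ c ∈ cs, ∀ u' ∈ c.labels, u' < acc.length) (u : ℕ),
    ((finalAcc cs π acc).getD u []).length =
      (acc.getD u []).length + countNat u (cs.flatMap Column.labels)
  | [], _, _, _, _, _ => by simp [finalAcc, countNat]
  | c :: cs, hcs, π, acc, hlab, u => by
    rw [finalAcc, length_finalAcc_getD cs (fun c' hc' => hcs c' (List.mem_cons_of_mem _ hc')) _ _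
      (fun c' hc' u' hu' => by
        rw [length_pushAll]; exact hlab c' (List.mem_cons_of_mem _ hc') u' hu'),
      length_pushAll_getD acc c.labels (permVars c (π 0))
        (by rw [permVars, List.length_ofFn, (hcs c List.mem_cons_self).symm])
        (hlab c List.mem_cons_self),
      List.flatMap_cons, countNat, countNat, countNat, List.filter_append, List.length_append]
    omega

omit [Fintype σ] [DecidableEq σ] in
/-- Letters of the final words are initial letters or variables of the columns. [folklore] -/
theorem mem_finalAcc_getD : ∀ (cs : List Column) (π : BijL cs) (acc : List (List ℕ)) (u j : ℕ),
    j ∈ (finalAcc cs π acc).getD u [] → j ∈ acc.getD u [] ∨ ∃ c ∈ cs, j ∈ c.vars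
  | [], _, _, _, _, h => Or.inl (by simpa [finalAcc] using h)
  | c :: cs, π, acc, u, j, h => by
    rw [finalAcc] at h
    rcases mem_finalAcc_getD cs _ _ u j h with h1 | ⟨c', hc', hj⟩
    · rcases mem_pushAll_getD acc c.labels _ u j h1 with h2 | h2
      · exact Or.inl h2
      · refine Or.inr ⟨c, List.mem_cons_self, ?_⟩
        rw [permVars, List.mem_ofFn] at h2
        obtain ⟨r, rfl⟩ := h2
        exact List.get_mem _ _
    · exact Or.inr ⟨c', List.mem_cons_of_mem _ hc', hj⟩

/-! ## §5 The closed form of `evalC` -/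

/-- **Closed form of the kernel evaluator**: for a list point all of whose terms have `m` forms
and a network with `d` labels each on `m` boxes, equal-length alternator/label lists and
variables `< N`, `evalC P N = ∑_π sgn(π) ∏_{u<d} S(∑_i colContent_i(π_i, u))`. [folklore] -/
theorem evalC_eq_sum_S (P : Point K) (N : Network)
    (hP : ∀ t : Fin P.terms.length, (P.terms.get t).2.length = N.perLabel)
    (hlen : ∀ c ∈ N.cols, c.vars.length = c.labels.length)
    (hvar : ∀ c ∈ N.cols, ∀ i ∈ c.vars, i < Nv)
    (hlab : ∀ c ∈ N.cols, ∀ u ∈ c.labels, u < N.nlabels)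
    (hcnt : ∀ u, u < N.nlabels → countNat u N.allLabels = N.perLabel) :
    evalC P N = ∑ π : BijL N.cols, sgnL N.cols π *
      ∏ u : Fin N.nlabels, Sfun E P N.perLabel (∑ i, colContent E (N.cols.get i) (π i) u) := by
  unfold evalC
  rw [evalCols_eq_sum]
  refine Finset.sum_congr rfl fun π _ => ?_
  congr 1
  set L := finalAcc N.cols π (List.replicate N.nlabels []) with hL
  have hl : L.length = N.nlabels := by
    rw [hL, length_finalAcc, List.length_replicate]
  rw [prod_map_eq_prod_get]
  -- the `n`-th final word: length `m`, letters `< Nv`, content `∑ colContent`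
  have hword : ∀ n : ℕ, n < N.nlabels →
      (L.getD n []).length = N.perLabel ∧ (∀ j ∈ L.getD n [], j < Nv) ∧
        contentL E (L.getD n []) = ∑ k, colContent E (N.cols.get k) (π k) n := by
    intro n hn
    have hrep : (List.replicate N.nlabels ([] : List ℕ)).getD n [] = [] := by
      rw [List.getD_eq_getElem _ _ (by simpa using hn)]; simp
    refine ⟨?_, ?_, ?_⟩
    · rw [hL, length_finalAcc_getD N.cols hlen π _ (fun c hc u hu => by
        rw [List.length_replicate]; exact hlab c hc u hu), hrep]
      have := hcnt n hn
      rw [Network.allLabels] at this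
      rw [this]
      simp
    · intro j hj
      rw [hL] at hj
      rcases mem_finalAcc_getD N.cols π _ n j hj with h | ⟨c, hc, hjc⟩
      · rw [hrep] at h; simp at h
      · exact hvar c hc j hjc
    · rw [hL, contentL_finalAcc E N.cols hlen π _ n (by simpa using hn), hrep]
      simp [contentL]
  refine Fintype.prod_equiv (finCongr hl) _ _ fun i => ?_
  obtain ⟨h1, h2, h3⟩ := hword i (hl ▸ i.isLt)
  have hget : L.get i = L.getD i [] := by rw [List.getD_eq_getElem _ _ i.isLt]; rfl
  rw [hget, symEntry_eq_S E P hP _ h1 h2, h3]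
  rfl

/-! ## §6 The tableau datum of a network -/

/-- The boxes of a list network: (column index, row). [folklore] -/
abbrev NetBox (N : Network) : Type := (i : Fin N.cols.length) × Fin (N.cols.get i).vars.length

/-- The label of a box. [folklore] -/
def netLab (N : Network) (b : NetBox N) : ℕ := (N.cols.get b.1).labels.getD b.2 0

/-- A frame of a list network: a bijective enumeration of the boxes of each label.
[folklore] -/
structure NetFrame (N : Network) where
  /-- `(label, index) ↦ box` -/
  box : Fin N.nlabels × Fin N.perLabel ≃ NetBox N
  /-- the enumerated box carries that label -/
  lab_box : ∀ u s, netLab N (box (u, s)) = u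

/-- **The tableau datum of a list network**: columns as listed, alternator variable of row `r`
of column `i` = `E.x (vars_i[r])`, boxes by the frame. [folklore] -/
def TabM.ofNetwork (N : Network) (F : NetFrame N) : TabM σ where
  C := N.cols.length
  d := N.nlabels
  m := N.perLabel
  h i := (N.cols.get i).vars.length
  var i r := E.x ((N.cols.get i).vars.get r)
  box u s := F.box (u, s)

/-- Its frame. [folklore] -/
def TabM.frameOfNetwork (N : Network) (F : NetFrame N) : (TabM.ofNetwork E N F).Frame :=
  ⟨F.box, fun _ _ => rfl⟩

omit [Fintype σ] [DecidableEq σ] in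
/-- The letter a box receives under a tuple of column bijections. [folklore] -/
theorem colContent_eq_sum (c : Column) (hc : c.vars.length = c.labels.length)
    (π : Equiv.Perm (Fin c.vars.length)) (u : ℕ) :
    colContent E c π u = ∑ r : Fin c.vars.length,
      if u = c.labels.getD r 0 then Finsupp.single (E.x (c.vars.get (π r))) 1 else 0 := by
  unfold colContent permVars
  have hl : c.labels = List.ofFn fun r : Fin c.vars.length => c.labels.getD r 0 := by
    apply List.ext_getElem
    · rw [List.length_ofFn, hc]
    · intro j h1 h2
      rw [List.getElem_ofFn, List.getD_eq_getElem]
  conv_lhs => rw [hl]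
  rw [zipWith_ofFn, List.sum_ofFn]

omit [Fintype σ] [DecidableEq σ] in
/-- **Contents agree**: the content of the word of label `u` in the tableau datum is the sum of
the column contributions computed from the program's data. [folklore] -/
theorem wordContent_ofNetwork (N : Network) (F : NetFrame N)
    (hlen : ∀ c ∈ N.cols, c.vars.length = c.labels.length) (π : (TabM.ofNetwork E N F).Bij)
    (u : Fin N.nlabels) :
    wordContent ((TabM.ofNetwork E N F).word π u) =
      ∑ i : Fin N.cols.length, colContent E (N.cols.get i) (π i) u := by
  classical
  -- right-hand side as a sum over boxes
  have hR : (∑ i : Fin N.cols.length, colContent E (N.cols.get i) (π i) u) =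
      ∑ b : NetBox N, if (u : ℕ) = netLab N b then
        Finsupp.single (E.x ((N.cols.get b.1).vars.get (π b.1 b.2))) 1 else 0 := by
    rw [Fintype.sum_sigma]
    refine Finset.sum_congr rfl fun i _ => ?_
    exact colContent_eq_sum E (N.cols.get i) (hlen _ (List.get_mem _ _)) (π i) u
  rw [hR, ← Finset.sum_filter]
  -- left-hand side: sum over `s`, reindexed through the frame onto the boxes of label `u`
  rw [wordContent]
  have himg : (Finset.univ.filter fun b : NetBox N => (u : ℕ) = netLab N b) =
      Finset.univ.image fun s : Fin N.perLabel => F.box (u, s) := by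
    ext b
    simp only [Finset.mem_filter, Finset.mem_univ, true_and, Finset.mem_image]
    constructor
    · intro hb
      refine ⟨(F.box.symm b).2, ?_⟩
      have h1 : (F.box.symm b).1 = u := by
        apply Fin.ext
        have := F.lab_box (F.box.symm b).1 (F.box.symm b).2
        rw [Prod.mk.eta, Equiv.apply_symm_apply] at this
        rw [← this]; exact hb.symm
      conv_rhs => rw [← F.box.apply_symm_apply b]
      rw [← h1]
    · rintro ⟨s, rfl⟩
      exact (F.lab_box u s).symm
  rw [himg, Finset.sum_image fun s _ s' _ h => by
    have := F.box.injective h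
    simpa using this]
  rfl

/-- **The kernel evaluator is the mathematical evaluator of the network's tableau datum** at the
presentation read off the list point: `evalC P N = (TabM.ofNetwork E N F).EC (coefM P) (formM E P m)`.
[folklore] -/
theorem TabM.EC_ofNetwork (P : Point K) (N : Network) (F : NetFrame N)
    (hP : ∀ t : Fin P.terms.length, (P.terms.get t).2.length = N.perLabel)
    (hlen : ∀ c ∈ N.cols, c.vars.length = c.labels.length)
    (hvar : ∀ c ∈ N.cols, ∀ i ∈ c.vars, i < Nv)
    (hlab : ∀ c ∈ N.cols, ∀ u ∈ c.labels, u < N.nlabels)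
    (hcnt : ∀ u, u < N.nlabels → countNat u N.allLabels = N.perLabel) :
    (TabM.ofNetwork E N F).EC (coefM P) (formM E P N.perLabel) = evalC P N := by
  rw [evalC_eq_sum_S E P N hP hlen hvar hlab hcnt]
  unfold TabM.EC
  refine Finset.sum_congr rfl fun π _ => ?_
  have hs : (((TabM.ofNetwork E N F).sgnProd π : ℤ) : K) = sgnL N.cols π := by
    simp only [TabM.sgnProd, sgnL, Units.coe_prod, Int.cast_prod]
    rfl
  rw [hs]
  congr 1
  refine Finset.prod_congr rfl fun u _ => ?_
  rw [symEntryM_eq, ← wordContent_ofNetwork E N F hlen π u]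
  rfl

/-! ### A frame exists when every label has `m` boxes -/

omit [Fintype σ] [DecidableEq σ] in
/-- Number of positions of a list holding `u`, as a cardinality over `Fin`. [folklore] -/
theorem card_filter_getD_eq_countNat (l : List ℕ) (u : ℕ) :
    (Finset.univ.filter fun r : Fin l.length => l.getD r 0 = u).card = countNat u l := by
  induction l with
  | nil => simp [countNat]
  | cons a l ih =>
    rw [countNat, List.filter_cons]
    have hsplit : (Finset.univ.filter fun r : Fin (a :: l).length => (a :: l).getD r 0 = u).card =
        (if a = u then 1 else 0) + (Finset.univ.filter fun r : Fin l.length => l.getD r 0 = u).card := by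
      rw [Finset.card_filter, Finset.card_filter]
      exact Fin.sum_univ_succ fun r : Fin (l.length + 1) => if (a :: l).getD r 0 = u then 1 else 0
    rw [hsplit, ih, countNat]
    by_cases h : a = u
    · simp [h]; omega
    · simp [h]

omit [Fintype σ] [DecidableEq σ] in
/-- Summing occurrence counts over the columns. [folklore] -/
theorem sum_countNat_get (u : ℕ) : ∀ cs : List Column,
    (∑ i : Fin cs.length, countNat u (cs.get i).labels) = countNat u (cs.flatMap Column.labels)
  | [] => by simp [countNat]
  | c :: cs => by
    have hsplit : (∑ i : Fin (c :: cs).length, countNat u ((c :: cs).get i).labels) =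
        countNat u c.labels + ∑ i : Fin cs.length, countNat u (cs.get i).labels :=
      Fin.sum_univ_succ fun i : Fin (cs.length + 1) => countNat u ((c :: cs).get i).labels
    rw [hsplit, sum_countNat_get u cs, List.flatMap_cons, countNat, countNat, countNat,
      List.filter_append, List.length_append]

omit [Fintype σ] [DecidableEq σ] in
/-- The boxes of label `u` are as many as the occurrences of `u` among all labels. [folklore] -/
theorem card_netLab_eq (N : Network) (hlen : ∀ c ∈ N.cols, c.vars.length = c.labels.length)
    (u : ℕ) : (Finset.univ.filter fun b : NetBox N => netLab N b = u).card = countNat u N.allLabels := by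
  classical
  rw [Finset.card_filter, Fintype.sum_sigma]
  have hcol : ∀ i : Fin N.cols.length,
      (∑ r : Fin (N.cols.get i).vars.length, if netLab N ⟨i, r⟩ = u then 1 else 0) =
        countNat u (N.cols.get i).labels := by
    intro i
    rw [← card_filter_getD_eq_countNat, Finset.card_filter]
    exact Fintype.sum_equiv (finCongr (hlen _ (List.get_mem _ _))) _ _ fun r => rfl
  simp only [hcol]
  rw [Network.allLabels]
  exact sum_countNat_get u N.cols

/-- **Existence of a frame** from the structural data: labels `< d` and exactly `m` boxes per
label. [folklore] -/
def NetFrame.ofCounts (N : Network) (hlen : ∀ c ∈ N.cols, c.vars.length = c.labels.length)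
    (hlab : ∀ c ∈ N.cols, ∀ u ∈ c.labels, u < N.nlabels)
    (hcnt : ∀ u, u < N.nlabels → countNat u N.allLabels = N.perLabel) : NetFrame N := by
  classical
  -- labels as a map to `Fin d`
  have hlt : ∀ b : NetBox N, netLab N b < N.nlabels := fun b =>
    hlab _ (List.get_mem _ _) _ (by
      unfold netLab
      rw [List.getD_eq_getElem _ _ (by rw [← hlen _ (List.get_mem _ _)]; exact b.2.isLt)]
      exact List.getElem_mem _)
  let labF : NetBox N → Fin N.nlabels := fun b => ⟨netLab N b, hlt b⟩
  have hcard : ∀ u : Fin N.nlabels, Fintype.card {b // labF b = u} = N.perLabel := by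
    intro u
    rw [Fintype.card_subtype, ← hcnt u u.isLt, ← card_netLab_eq N hlen u]
    congr 1
    ext b
    simp only [Finset.mem_filter, Finset.mem_univ, true_and, labF, Fin.ext_iff]
  let e : ∀ u : Fin N.nlabels, Fin N.perLabel ≃ {b // labF b = u} :=
    fun u => (Fintype.equivFinOfCardEq (hcard u)).symm
  refine ⟨((Equiv.sigmaEquivProd (Fin N.nlabels) (Fin N.perLabel)).symm.trans
    ((Equiv.sigmaCongrRight e).trans (Equiv.sigmaFiberEquiv labF))), fun u s => ?_⟩
  have h := (e u s).2
  simp only [labF, Fin.ext_iff] at h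
  exact h

end TableauEval

end Literature.Computability.AlgebraicComplexity

end
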